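import Mathlib
import HarnessLib

/-!
# Independent Gaussian limits ADD: under a finite product law, coordinates that converge in distribution to `N(0, v_r)` have a sum converging to `N(0, Σ_r v_r)` — the replica-pooling step, with the transfer of almost-sure and in-probability statements from a factor to the product

HONEST FRAMING: exact (Metropolis-corrected) sampling algorithms for lattice gauge theory;
figures of merit are autocorrelation/cost numbers at stated couplings and volumes; no
continuum-physics claim.

Venture `LatticeQCDFlow` (cell pub-lqcd), topic `Exactness`; FANOUT row 13 (`eng-snf`, GEN-23).
NEW WORK of the cell (a Lean proof of a textbook fact against Mathlib's characteristic functions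
`MeasureTheory.charFun`, Fubini on finite products `MeasureTheory.integral_fintype_prod_eq_prod` and
Lévy's continuity theorem `MeasureTheory.ProbabilityMeasure.tendsto_iff_tendsto_charFun`), not a
published result of ours; no definition is introduced; nothing is cited as a fact.  WHY (row 13): every
lane of the engine (`estimators.free_energy`, `reweight`, `bar`, `run_ncmc_chain`) is also run over
`R` independent REPLICAS — streams with their own seeds and launch configurations — whose records are
POOLED; GEN-19…GEN-22 typed each lane along ONE stream (a Markov chain with a Doeblin power, from
every initial law).  Pooling is the passage from the `R` one-stream central limit theorems, which hold
on `R` different probability spaces, to a central limit theorem on their PRODUCT: the characteristic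
function of a sum of independent coordinates is the product of the coordinates' characteristic
functions, each factor converges by Lévy's theorem, and a finite product of convergent sequences
converges.  §3 records the two transfer facts the pooled statements need besides the CLT: an
almost-sure (resp. in-probability) statement about one factor holds about that coordinate of the
product, and finite averages of coordinates converging in probability to constants converge in
probability to the average of the constants.  Related tree material, not restated: Mathlib's
`ProbabilityTheory.charFun_map_sum_pi_eq_prod` / `iIndepFun.charFun_map_fun_sum_eq_prod` (the sum of
the COORDINATES of a product law on one space; §1 is the form with a measurable statistic per factor on
factor-dependent spaces, proved directly by Fubini), and row 8's `Scoring/ReplicaChains.lean` (the grand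
mean of independent replica chains at the level of mean-square error and median-of-means confidence —
no limit law).

## Content (`ι` a finite index type; `P r` a probability law on `Ω r`; `Measure.pi P` their product)

* **`charFun_pi_map_sum`** — for measurable `X r : Ω r → ℝ`:
  `charFun ((Measure.pi P).map (ω ↦ Σ_r X r (ω r))) v = Π_r charFun ((P r).map (X r)) v`.
* **`tendstoInDistribution_pi_sum`** — THE POOLING LEMMA: if for every `r` the sequence `X r n`
  converges in distribution under `P r` to `N(0, v r)` (`v r : ℝ≥0`), then under `Measure.pi P` the
  sums `ω ↦ Σ_r X r n (ω r)` converge in distribution to ANY real random variable `Z` with law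
  `N(0, Σ_r v r)`.
* **`tendstoInDistribution_pi_invSqrt_mul_sum`** — equal variances `v`:
  `(√R)⁻¹ Σ_r X r n (ω r) ⇒ N(0, v)`, `R = Fintype.card ι ≠ 0`.
* `ae_pi_eval_of_ae`, **`tendstoInMeasure_pi_eval`**, `tendstoInMeasure_sum_const`,
  **`tendstoInMeasure_pi_avg`** — transfer of a.s. / in-probability statements from the factor `P r` to
  the product, and in-probability convergence of finite sums and of replica AVERAGES
  `(1/R) Σ_r T r n (ω r) → c` when every `T r n → c` in `P r`-probability.

NOT CLAIMED: dependent coordinates; non-Gaussian limits (the proof is written for centred Gaussian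
limits only, which is all the pooled lanes use); rates; anything numerical.
-/

namespace Summit.Ventures.LatticeQCDFlow.Exactness.GeneralNCMC

open MeasureTheory ProbabilityTheory Set Filter Finset Complex
open scoped ENNReal NNReal Topology

section IndependentSum

variable {ι : Type*} [Fintype ι] {Ω : ι → Type*} [∀ r, MeasurableSpace (Ω r)]
  {P : (r : ι) → Measure (Ω r)} [∀ r, IsProbabilityMeasure (P r)]

/-! ## §1 The characteristic function of a sum of independent coordinates -/

/-- **`φ_{Σ_r X_r}(v) = Π_r φ_{X_r}(v)` under a product law.**  For measurable `X r : Ω r → ℝ`,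
`charFun ((Measure.pi P).map (ω ↦ Σ_r X r (ω r))) v = Π_r charFun ((P r).map (X r)) v`. -/
theorem charFun_pi_map_sum {X : (r : ι) → Ω r → ℝ} (hX : ∀ r, Measurable (X r)) (v : ℝ) :
    charFun ((Measure.pi P).map fun ω : (r : ι) → Ω r => ∑ r, X r (ω r)) v
      = ∏ r, charFun ((P r).map (X r)) v := by
  have hm : Measurable fun ω : (r : ι) → Ω r => ∑ r, X r (ω r) :=
    Finset.measurable_sum _ fun r _ => (hX r).comp (measurable_pi_apply r)
  rw [charFun_apply_real, integral_map hm.aemeasurable (by fun_prop)]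
  have h2 : ∀ r, charFun ((P r).map (X r)) v
      = ∫ ω, Complex.exp ((v : ℂ) * ((X r ω : ℝ) : ℂ) * I) ∂(P r) := by
    intro r
    rw [charFun_apply_real, integral_map (hX r).aemeasurable (by fun_prop)]
  simp only [h2]
  rw [← integral_fintype_prod_eq_prod
    (fun r (ω : Ω r) => Complex.exp ((v : ℂ) * ((X r ω : ℝ) : ℂ) * I))]
  refine integral_congr_ae (Eventually.of_forall fun ω => ?_)
  show Complex.exp ((v : ℂ) * ((∑ r, X r (ω r) : ℝ) : ℂ) * I)
    = ∏ r, Complex.exp ((v : ℂ) * ((X r (ω r) : ℝ) : ℂ) * I)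
  rw [← Complex.exp_sum]
  congr 1
  push_cast
  rw [Finset.mul_sum, Finset.sum_mul]

/-! ## §2 Independent Gaussian limits add -/

/-- **THE POOLING LEMMA.**  `ι` finite; for every `r`, `X r n : Ω r → ℝ` measurable and
`X r n ⇒ N(0, v r)` under `P r` (stated against the canonical variable `id` on `(ℝ, gaussianReal 0 (v r))`).
Then for EVERY real random variable `Z` with law `N(0, Σ_r v r)`:
`(ω ↦ Σ_r X r n (ω r)) ⇒ Z` under the product law `Measure.pi P`. -/
theorem tendstoInDistribution_pi_sum {X : (r : ι) → ℕ → Ω r → ℝ} (hX : ∀ r n, Measurable (X r n))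
    {v : ι → ℝ≥0}
    (h : ∀ r, TendstoInDistribution (X r) atTop id (fun _ => P r) (gaussianReal 0 (v r)))
    {Ω' : Type*} [MeasurableSpace Ω'] {P' : Measure Ω'} [IsProbabilityMeasure P'] {Z : Ω' → ℝ}
    (hZ : HasLaw Z (gaussianReal 0 (∑ r, v r)) P') :
    TendstoInDistribution (fun (n : ℕ) (ω : (r : ι) → Ω r) => ∑ r, X r n (ω r)) atTop Z
      (fun _ => Measure.pi P) P' := by
  have hm : ∀ n, Measurable fun ω : (r : ι) → Ω r => ∑ r, X r n (ω r) := fun n =>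
    Finset.measurable_sum _ fun r _ => (hX r n).comp (measurable_pi_apply r)
  refine ⟨fun n => (hm n).aemeasurable, hZ.aemeasurable, ?_⟩
  refine ProbabilityMeasure.tendsto_iff_tendsto_charFun.2 fun u => ?_
  have hL : ∀ n : ℕ, charFun ((Measure.pi P).map fun ω : (r : ι) → Ω r => ∑ r, X r n (ω r)) u
      = ∏ r, charFun ((P r).map (X r n)) u := fun n => charFun_pi_map_sum (fun r => hX r n) u
  have hR : charFun (P'.map Z) u = ∏ r, Complex.exp (-((v r : ℂ) * u ^ 2 / 2)) := by
    rw [hZ.map_eq, charFun_gaussianReal, ← Complex.exp_sum]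
    congr 1
    push_cast
    rw [Finset.sum_neg_distrib, ← Finset.sum_div, ← Finset.sum_mul]
    ring
  simp only [ProbabilityMeasure.coe_mk, hL, hR]
  refine tendsto_finsetProd _ fun r _ => ?_
  -- the `r`-th factor converges by Lévy's theorem applied to `h r`
  have hr := (ProbabilityMeasure.tendsto_iff_tendsto_charFun.1 (h r).tendsto) u
  simp only [ProbabilityMeasure.coe_mk, Measure.map_id, charFun_gaussianReal] at hr
  have hlim : Complex.exp ((u : ℂ) * ((0 : ℝ) : ℂ) * I - ((v r : ℝ) : ℂ) * (u : ℂ) ^ 2 / 2)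
      = Complex.exp (-(((v r : ℝ) : ℂ) * (u : ℂ) ^ 2 / 2)) := by
    congr 1
    rw [Complex.ofReal_zero, mul_zero, zero_mul, zero_sub]
  rw [hlim] at hr
  exact hr

/-- **Equal variances, the `√R` normalisation.**  If every `X r n ⇒ N(0, v)` under `P r` then
`(√R)⁻¹ Σ_r X r n (ω r) ⇒ N(0, v)` under `Measure.pi P` (`R = Fintype.card ι ≠ 0`), for every `Z`
with law `N(0, v)`. -/
theorem tendstoInDistribution_pi_invSqrt_mul_sum [Nonempty ι] {X : (r : ι) → ℕ → Ω r → ℝ}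
    (hX : ∀ r n, Measurable (X r n)) {v : ℝ≥0}
    (h : ∀ r, TendstoInDistribution (X r) atTop id (fun _ => P r) (gaussianReal 0 v))
    {Ω' : Type*} [MeasurableSpace Ω'] {P' : Measure Ω'} [IsProbabilityMeasure P'] {Z : Ω' → ℝ}
    (hZ : HasLaw Z (gaussianReal 0 v) P') :
    TendstoInDistribution (fun (n : ℕ) (ω : (r : ι) → Ω r) =>
        (Real.sqrt (Fintype.card ι))⁻¹ * ∑ r, X r n (ω r)) atTop Z
      (fun _ => Measure.pi P) P' := by
  set R : ℕ := Fintype.card ι with hRdef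
  have hR0 : (R : ℝ) ≠ 0 := by exact_mod_cast (Fintype.card_ne_zero : R ≠ 0)
  have hRpos : 0 < (R : ℝ) := by positivity
  -- the un-normalised sum against the canonical variable of `N(0, R • v)`
  have hsum := tendstoInDistribution_pi_sum (P := P) hX (v := fun _ => v) h
    (P' := gaussianReal 0 (∑ _r : ι, v)) (Z := id) HasLaw.id
  -- continuous mapping: multiply by `(√R)⁻¹`
  have hmul := hsum.continuous_comp (g := fun x : ℝ => (Real.sqrt R)⁻¹ * x) (by fun_prop)
  -- the law of `(√R)⁻¹ · N(0, R v)` is `N(0, v)`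
  have hcard : (∑ _r : ι, v) = (R : ℝ≥0) * v := by
    rw [Finset.sum_const, Finset.card_univ, nsmul_eq_mul]
  have hvar : NNReal.mk (((Real.sqrt R)⁻¹) ^ 2) (sq_nonneg _) * (∑ _r : ι, v) = v := by
    rw [hcard]
    apply NNReal.eq
    simp only [NNReal.coe_mul, NNReal.coe_mk, NNReal.coe_natCast, inv_pow, Real.sq_sqrt hRpos.le]
    field_simp
  have hlaw : HasLaw ((fun x : ℝ => (Real.sqrt R)⁻¹ * x) ∘ id) (gaussianReal 0 v)
      (gaussianReal 0 (∑ _r : ι, v)) := by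
    have h1 := gaussianReal_const_mul (HasLaw.id (μ := gaussianReal 0 (∑ _r : ι, v))) (Real.sqrt R)⁻¹
    rw [mul_zero, hvar] at h1
    exact h1
  refine ⟨hmul.forall_aemeasurable, hZ.aemeasurable, ?_⟩
  have ht := hmul.tendsto
  have heq : (⟨P'.map Z, Measure.isProbabilityMeasure_map hZ.aemeasurable⟩ : ProbabilityMeasure ℝ)
      = ⟨(gaussianReal 0 (∑ _r : ι, v)).map ((fun x : ℝ => (Real.sqrt R)⁻¹ * x) ∘ id),
        Measure.isProbabilityMeasure_map hmul.aemeasurable_limit⟩ := by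
    apply Subtype.ext
    show P'.map Z = (gaussianReal 0 (∑ _r : ι, v)).map ((fun x : ℝ => (Real.sqrt R)⁻¹ * x) ∘ id)
    rw [hZ.map_eq, hlaw.map_eq]
  rw [heq]
  exact ht

/-! ## §3 Transfer from a factor to the product; averages of coordinates -/

/-- An almost-sure statement about the factor `P r` holds about the `r`-th coordinate of the product.
-/
theorem ae_pi_eval_of_ae (r : ι) {p : Ω r → Prop} (h : ∀ᵐ x ∂(P r), p x) :
    ∀ᵐ ω ∂(Measure.pi P), p (ω r) :=
  (measurePreserving_eval P r).quasiMeasurePreserving.ae h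

/-- **In-probability statements transfer**: if `T n → c` in `P r`-probability (`T n` measurable) then
`ω ↦ T n (ω r)` converges to `c` in `Measure.pi P`-probability. -/
theorem tendstoInMeasure_pi_eval (r : ι) {T : ℕ → Ω r → ℝ} (hT : ∀ n, Measurable (T n)) {c : ℝ}
    (h : TendstoInMeasure (P r) T atTop (fun _ => c)) :
    TendstoInMeasure (Measure.pi P) (fun n (ω : (r : ι) → Ω r) => T n (ω r)) atTop (fun _ => c) := by
  rw [tendstoInMeasure_iff_dist] at h ⊢
  intro ε hε
  refine (h ε hε).congr fun n => ?_
  have hset : MeasurableSet {x : Ω r | ε ≤ dist (T n x) c} :=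
    measurableSet_le measurable_const ((hT n).dist measurable_const)
  rw [← (measurePreserving_eval P r).measure_preimage hset.nullMeasurableSet]
  rfl

omit [Fintype ι] in
/-- **Finite sums of sequences converging in probability to constants** converge in probability to
the sum of the constants (any finite measure space). -/
theorem tendstoInMeasure_sum_const {Ω₀ : Type*} [MeasurableSpace Ω₀] {μ : Measure Ω₀}
    [IsFiniteMeasure μ] (s : Finset ι) {T : ι → ℕ → Ω₀ → ℝ} {c : ι → ℝ}
    (h : ∀ r ∈ s, TendstoInMeasure μ (T r) atTop (fun _ => c r)) :
    TendstoInMeasure μ (fun n ω => ∑ r ∈ s, T r n ω) atTop (fun _ => ∑ r ∈ s, c r) := by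
  classical
  induction s using Finset.induction_on with
  | empty =>
    simp only [Finset.sum_empty]
    rw [tendstoInMeasure_iff_dist]
    intro ε hε
    simp only [dist_self, not_le.2 hε, setOf_false, measure_empty]
    exact tendsto_const_nhds
  | insert a s ha ih =>
    simp only [Finset.sum_insert ha]
    have hA := h a (Finset.mem_insert_self a s)
    have hS := ih fun r hr => h r (Finset.mem_insert_of_mem hr)
    -- `{ε ≤ |(A − a) + (S − s)|} ⊆ {ε/2 ≤ |A − a|} ∪ {ε/2 ≤ |S − s|}`
    rw [tendstoInMeasure_iff_dist] at hA hS ⊢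
    intro ε hε
    have hε2 : 0 < ε / 2 := by linarith
    have hsub : ∀ n, {ω : Ω₀ | ε ≤ dist (T a n ω + ∑ r ∈ s, T r n ω) (c a + ∑ r ∈ s, c r)}
        ⊆ {ω | ε / 2 ≤ dist (T a n ω) (c a)} ∪ {ω | ε / 2 ≤ dist (∑ r ∈ s, T r n ω) (∑ r ∈ s, c r)} := by
      intro n ω hω
      simp only [mem_setOf_eq, mem_union, Real.dist_eq] at hω ⊢
      have htri : |T a n ω + ∑ r ∈ s, T r n ω - (c a + ∑ r ∈ s, c r)|
          ≤ |T a n ω - c a| + |∑ r ∈ s, T r n ω - ∑ r ∈ s, c r| := by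
        have heq : T a n ω + ∑ r ∈ s, T r n ω - (c a + ∑ r ∈ s, c r)
            = (T a n ω - c a) + (∑ r ∈ s, T r n ω - ∑ r ∈ s, c r) := by ring
        rw [heq]
        exact abs_add_le _ _
      by_cases h1 : ε / 2 ≤ |T a n ω - c a|
      · exact Or.inl h1
      · right
        linarith [not_le.1 h1]
    have hle : ∀ n, μ {ω : Ω₀ | ε ≤ dist (T a n ω + ∑ r ∈ s, T r n ω) (c a + ∑ r ∈ s, c r)}
        ≤ μ {ω | ε / 2 ≤ dist (T a n ω) (c a)}
          + μ {ω | ε / 2 ≤ dist (∑ r ∈ s, T r n ω) (∑ r ∈ s, c r)} := fun n =>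
      (measure_mono (hsub n)).trans (measure_union_le _ _)
    have hlim : Tendsto (fun n => μ {ω | ε / 2 ≤ dist (T a n ω) (c a)}
        + μ {ω | ε / 2 ≤ dist (∑ r ∈ s, T r n ω) (∑ r ∈ s, c r)}) atTop (𝓝 0) := by
      simpa using (hA (ε / 2) hε2).add (hS (ε / 2) hε2)
    exact tendsto_of_tendsto_of_tendsto_of_le_of_le tendsto_const_nhds hlim
      (fun n => zero_le) hle

/-- **Replica averages**: if for every `r` the statistic `T r n` converges to `c` in `P r`-probability
(`T r n` measurable), then the replica average `(1/R) Σ_r T r n (ω r)` converges to `c` in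
`Measure.pi P`-probability (`R = Fintype.card ι ≠ 0`). -/
theorem tendstoInMeasure_pi_avg [Nonempty ι] {T : (r : ι) → ℕ → Ω r → ℝ}
    (hT : ∀ r n, Measurable (T r n)) {c : ℝ}
    (h : ∀ r, TendstoInMeasure (P r) (T r) atTop (fun _ => c)) :
    TendstoInMeasure (Measure.pi P)
      (fun n (ω : (r : ι) → Ω r) => (∑ r, T r n (ω r)) / Fintype.card ι) atTop (fun _ => c) := by
  have hR0 : (Fintype.card ι : ℝ) ≠ 0 := by exact_mod_cast (Fintype.card_ne_zero : Fintype.card ι ≠ 0)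
  have hsum := tendstoInMeasure_sum_const (μ := Measure.pi P) Finset.univ
    (T := fun r n (ω : (r : ι) → Ω r) => T r n (ω r)) (c := fun _ => c)
    (fun r _ => tendstoInMeasure_pi_eval r (hT r) (h r))
  have hc : (∑ _r : ι, c) / Fintype.card ι = c := by
    rw [Finset.sum_const, Finset.card_univ, nsmul_eq_mul]
    field_simp
  rw [tendstoInMeasure_iff_dist] at hsum ⊢
  intro ε hε
  have hRpos : 0 < (Fintype.card ι : ℝ) := by positivity
  refine (hsum (ε * Fintype.card ι) (by positivity)).congr fun n => ?_
  congr 1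
  ext ω
  simp only [mem_setOf_eq, Real.dist_eq]
  rw [← hc, ← sub_div, abs_div, abs_of_pos hRpos, le_div_iff₀ hRpos, hc]

end IndependentSum

end Summit.Ventures.LatticeQCDFlow.Exactness.GeneralNCMC
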